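import Literature.Probability.LatticeModels.DobrushinMetricInfiniteRangeEstimate
import HarnessLib

/-!
# Dobrushin's comparison and covariance estimates in the Vasserstein form, infinite range with
summable rows, VI: covariances of the CONDITIONAL specification (finite-volume kernels), uniformly in
the volume and the boundary condition

Sequel of `DobrushinMetricInfiniteRangeEstimate.lean` (the sweep from a bounded estimate down to a bounded
super-solution, and the estimate `R·𝟙_Λ` for a kernel `γ_Λ(·|η)` and its tilt). Here the two are combined for the
conditional specification `π^{J,η}` of Föllmer 1988, Ch. I, (2.10) — the kernels `γ_Λ(· | η)` of a finite volume `Λ`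
with the outside frozen at `η` — under the global Kantorovich–Rubinstein bound with SUMMABLE rows of
`DobrushinMetricInfiniteRange.lean` (no finite set of neighbours):

* `abs_tilt_sub_kernel_le_of_summable_weighted` — Comparison Theorem (2.8) with Cor. (2.14) for the pair
  `γ_Λ(·|η)`, `g γ_Λ(·|η)/γ_Λ(g|η)` (`g ≥ 0` local on `Δ_g`): both are invariant under `γ_x`, `x ∈ Λ ∖ Δ_g`
  (consistency; properness for the tilt), so under the weighted row condition `∑' y, C x y θ y ≤ c θ x` (`x ∉ Δ_g`,
  `θ = 1` on `Δ_g`): `|γ_Λ(f|η) − γ_Λ(g f|η)/γ_Λ(g|η)| ≤ R ∑_{y ∈ Δ_f} θ y δ_f y`;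
* **`abs_covariance_kernel_le_of_summable_weighted`** — Thm. (2.13)/(2.14) for the conditional specification:
  `|cov_{γ_Λ(·|η)}(f, g)| ≤ 2 R² (∑ δ_g) ∑_{Δ_f} θ δ_f`, for EVERY finite `Λ` and EVERY `η`, the same constant as
  `abs_covariance_le_of_summable_weighted` gives for Gibbs measures (no loss near the boundary of `Λ`): the
  Lipschitz-observable (Kantorovich) form of Dobrushin–Shlosman's finite-volume mixing condition for infinite-range
  one-site laws.

Theorems only: no definition, no named fact. The finite-range, finite-`nbr` analogue is the venture file
`Summits/Ventures/YMGap/RobustBall/KernelClustering.lean` (via `DobrushinComparisonBoundary.lean`). NOT here: the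
exponential-weight readings (left to the users: `θ = e^{−t ρ}` exactly as in
`abs_covariance_le_of_summable_exp_profile`), the total-variation form of finite-volume mixing (Dobrushin–Shlosman 1987 in
full), complete analyticity, log-Sobolev inequalities.

## References

* H. Föllmer, *Random fields and diffusion processes*, LNM 1362 (1988), Ch. I §2: Lemma (2.5), Comparison Theorem (2.8),
  (2.10) (conditional specification), Thm. (2.13), Cor. (2.14), Remark (2.17), (2.22)–(2.24).
* H.-O. Georgii, *Gibbs Measures and Phase Transitions*, 2nd ed. (2011), Def. 1.23, Thm. 8.20, Remark 8.26.
* R. L. Dobrushin, S. B. Shlosman, J. Stat. Phys. 46 (1987) 983–1014 (finite-volume mixing conditions).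
* H. Künsch, CMP 84 (1982) 207–222.
-/

noncomputable section

open MeasureTheory ProbabilityTheory Finset Function Filter
open scoped Topology

namespace Literature.Probability.LatticeModels

namespace DobrushinMetric

section Kernel

variable {V S : Type*} [MeasurableSpace S] {γ : Specification V S} {r : S → S → ℝ} {C : V → V → ℝ}

/-- **Kernel against tilted kernel under the weighted row-sum condition, summable rows, Vasserstein form, UNIFORMLY
in the volume and the boundary condition** (Föllmer 1988, Ch. I, Comparison Theorem (2.8) with Cor. (2.14) for the
conditional specification (2.10)): let the one-site laws of `γ` satisfy the global Kantorovich–Rubinstein bound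
`|∫ φ dγ_x(·|ω) − ∫ φ dγ_x(·|η)| ≤ L ∑' y, C x y · r(ω y, η y)` (`0 ≤ r ≤ R`, `r a a = 0`, `C ≥ 0` with summable rows).
Let `g ≥ 0` be bounded measurable depending on `Δ_g`, `γ_Λ(g|η) > 0`; off `Δ_g` let the rows be `≤ c < 1` and let a
weight `0 ≤ θ ≤ 1`, `= 1` on `Δ_g`, satisfy `∑' y, C x y θ y ≤ c θ x`. Then for every bounded measurable `f`
depending on `Δ_f` with coordinatewise Lipschitz bound `δ_f`:
`|γ_Λ(f|η) − γ_Λ(g f|η)/γ_Λ(g|η)| ≤ R ∑_{y ∈ Δ_f} θ y δ_f y` — for EVERY finite `Λ` and EVERY `η`: both functionals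
are invariant under `γ_x`, `x ∈ Λ ∖ Δ_g` (consistency; properness for the tilt), and the sweep runs from the estimate
`R·𝟙_Λ` to the super-solution `R θ`. [cite: Follmer1988, Ch. I (2.10)] -/
theorem abs_tilt_sub_kernel_le_of_summable_weighted [DecidableEq V] (hγ : IsSpecification γ)
    {R : ℝ} (hr0 : ∀ a b, 0 ≤ r a b) (hrR : ∀ a b, r a b ≤ R) (hR : 0 ≤ R)
    (hr00 : ∀ a, r a a = 0) (hC0 : ∀ x y, 0 ≤ C x y) (hCs : ∀ x, Summable (C x))
    (hcontr : ∀ (x : V) (ω η : V → S) (φ : S → ℝ) (L : ℝ), Measurable φ →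
      (∃ M, ∀ s, |φ s| ≤ M) → 0 ≤ L → (∀ a b, |φ a - φ b| ≤ L * r a b) →
      |∫ s, φ s ∂(siteLaw γ x ω) - ∫ s, φ s ∂(siteLaw γ x η)| ≤
        L * ∑' y, C x y * r (ω y) (η y))
    (Λ : Finset V) (η : V → S) {g : (V → S) → ℝ} (hgm : Measurable g) {Δg : Finset V}
    (hgdep : DependsOn g (↑Δg : Set V)) (hg0 : ∀ σ, 0 ≤ g σ) {Bg : ℝ} (hgB : ∀ σ, g σ ≤ Bg)
    (hgpos : 0 < ∫ σ, g σ ∂(γ Λ η)) {c : ℝ} (hc0 : 0 ≤ c) (hc1 : c < 1)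
    (hrow : ∀ x ∉ Δg, ∑' y, C x y ≤ c) {θ : V → ℝ} (hθ0 : ∀ y, 0 ≤ θ y) (hθ1 : ∀ y, θ y ≤ 1)
    (hθg : ∀ y ∈ Δg, θ y = 1) (hroww : ∀ x ∉ Δg, ∑' y, C x y * θ y ≤ c * θ x)
    {f : (V → S) → ℝ} (hfm : Measurable f) {Δf : Finset V} (hfdep : DependsOn f (↑Δf : Set V))
    {Mf : ℝ} (hMf : ∀ σ, |f σ| ≤ Mf) {δf : V → ℝ} (hδf : IsLipBound r f δf) :
    |(∫ σ, f σ ∂(γ Λ η)) - (∫ σ, g σ * f σ ∂(γ Λ η)) / ∫ σ, g σ ∂(γ Λ η)| ≤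
      R * ∑ y ∈ Δf, θ y * δf y := by
  classical
  haveI := hγ.isProbability Λ η
  -- the two predicates of the abstract layer (Föllmer's class `L(Ω)`)
  set Adm : ((V → S) → ℝ) → Prop := fun F => Measurable F ∧ ∃ M, ∀ σ, |F σ| ≤ M with hAdmdef
  set Lip : ((V → S) → ℝ) → (V → ℝ) → Prop := fun F δ =>
    (∀ y, 0 ≤ δ y) ∧ Summable δ ∧ ∀ σ τ, |F σ - F τ| ≤ ∑' y, δ y * r (σ y) (τ y) with hLipdef
  have hlip0 : ∀ ⦃F : (V → S) → ℝ⦄ ⦃δ : V → ℝ⦄, Lip F δ → ∀ y, 0 ≤ δ y := fun F δ h => h.1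
  have hlips : ∀ ⦃F : (V → S) → ℝ⦄ ⦃δ : V → ℝ⦄, Lip F δ → Summable δ := fun F δ h => h.2.1
  have hT : ∀ ⦃F : (V → S) → ℝ⦄ (x : V), Adm F → Adm (siteAvg γ x F) := fun F x hF => by
    obtain ⟨hFm, M, hM⟩ := hF
    exact ⟨measurable_siteAvg hγ x hFm, M, fun σ => abs_siteAvg_le hγ x hM σ⟩
  have hdust : ∀ ⦃F : (V → S) → ℝ⦄ ⦃δ : V → ℝ⦄ (x : V), Adm F → Lip F δ →
      Lip (siteAvg γ x F) fun y => if y = x then 0 else δ y + C x y * δ x := fun F δ x hF h => by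
    obtain ⟨hFm, M, hM⟩ := hF
    obtain ⟨hδ0, hδs, hδ⟩ := h
    refine ⟨fun y => ?_, ?_, lip_siteAvg_tsum hγ hr0 hrR hr00 hC0 hCs hcontr x hFm hM hδ0 hδs hδ⟩
    · show 0 ≤ (if y = x then 0 else δ y + C x y * δ x)
      split_ifs
      · exact le_rfl
      · exact add_nonneg (hδ0 y) (mul_nonneg (hC0 x y) (hδ0 x))
    · exact Summable.of_nonneg_of_le
        (fun y => by
          split_ifs; exacts [le_rfl, add_nonneg (hδ0 y) (mul_nonneg (hC0 x y) (hδ0 x))])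
        (fun y => by
          split_ifs
          · exact add_nonneg (hδ0 y) (mul_nonneg (hC0 x y) (hδ0 x))
          · exact le_rfl)
        (hδs.add ((hCs x).mul_right (δ x)))
  -- usable set `W = Λ ∖ Δ_g`
  set W : Set V := (↑Λ : Set V) \ ↑Δg with hW
  have hmemW : ∀ {x : V}, x ∈ W → x ∈ Λ ∧ x ∉ Δg := fun {x} hx =>
    ⟨Finset.mem_coe.1 hx.1, fun h' => hx.2 (Finset.mem_coe.2 h')⟩
  -- `E₁ = γ_Λ(·|η)` is invariant under `γ_x`, `x ∈ Λ` (consistency)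
  have h₁T : ∀ ⦃F : (V → S) → ℝ⦄ (x : V), x ∈ W → Adm F →
      ∫ σ, siteAvg γ x F σ ∂(γ Λ η) = ∫ σ, F σ ∂(γ Λ η) := fun F x hx hF => by
    obtain ⟨hFm, M, hM⟩ := hF
    exact hγ.integral_integral_consistent (Finset.singleton_subset_iff.2 (hmemW hx).1) η
      (integrable_of_abs_le' hFm hM)
  -- `E₂ = g γ_Λ(·|η) / γ_Λ(g|η)` is invariant under `γ_x`, `x ∈ Λ ∖ Δ_g` (properness + consistency)
  have hgabs : ∀ σ, |g σ| ≤ Bg := fun σ => by rw [abs_of_nonneg (hg0 σ)]; exact hgB σ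
  have hgi : Integrable g (γ Λ η) := integrable_of_abs_le' hgm hgabs
  have hgfi : ∀ {F : (V → S) → ℝ}, Measurable F → ∀ {M : ℝ}, (∀ σ, |F σ| ≤ M) →
      Integrable (fun σ => g σ * F σ) (γ Λ η) := fun hFm M hM =>
    hgi.mul_bdd hFm.aestronglyMeasurable (ae_of_all _ fun σ => by
      rw [Real.norm_eq_abs]; exact hM σ)
  have h₂T : ∀ ⦃F : (V → S) → ℝ⦄ (x : V), x ∈ W → Adm F →
      (∫ σ, g σ * siteAvg γ x F σ ∂(γ Λ η)) / ∫ σ, g σ ∂(γ Λ η) =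
        (∫ σ, g σ * F σ ∂(γ Λ η)) / ∫ σ, g σ ∂(γ Λ η) := fun F x hx hF => by
    obtain ⟨hFm, M, hM⟩ := hF
    obtain ⟨hxΛ, hxΔ⟩ := hmemW hx
    have hpt : ∀ ζ, g ζ * siteAvg γ x F ζ = ∫ σ, g σ * F σ ∂(γ {x} ζ) := fun ζ => by
      rw [siteAvg, ← integral_const_mul]
      refine integral_congr_ae ?_
      filter_upwards [hγ.proper {x} ζ] with σ hσ
      rw [hgdep fun i hi => (hσ i fun hix => hxΔ ?_).symm]
      rwa [Finset.mem_singleton.1 hix] at hi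
    congr 1
    simp_rw [hpt]
    exact hγ.integral_integral_consistent (Finset.singleton_subset_iff.2 hxΛ) η (hgfi hFm hM)
  -- the estimate `R·𝟙_Λ`
  have ha : ∀ ⦃F : (V → S) → ℝ⦄ ⦃δ : V → ℝ⦄, Adm F → Lip F δ →
      |(∫ σ, F σ ∂(γ Λ η)) - (∫ σ, g σ * F σ ∂(γ Λ η)) / ∫ σ, g σ ∂(γ Λ η)| ≤
        ∑' y, (if y ∈ Λ then R else 0) * δ y := fun F δ hF h => by
    obtain ⟨hFm, M, hM⟩ := hF
    obtain ⟨hδ0, hδs, hδ⟩ := h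
    exact abs_kernel_sub_tilt_le_tsum_indicator hγ hr0 hrR hR hr00 Λ η hgm hg0 hgB hgpos hFm hM hδ0 hδs
      hδ
  -- rows on `W`, the super-solution `R θ`, the initial domination
  have hrowW : ∀ y ∈ W, ∑' z, C y z ≤ c := fun y hy => hrow y (hmemW hy).2
  have hsol : ∀ y ∈ W, ∑' z, C y z * (R * θ z) ≤ R * θ y := fun y hy => by
    have h1 : ∑' z, C y z * (R * θ z) = R * ∑' z, C y z * θ z := by
      rw [← tsum_mul_left]; exact tsum_congr fun z => by ring
    rw [h1]
    calc R * ∑' z, C y z * θ z ≤ R * (c * θ y) := mul_le_mul_of_nonneg_left (hroww y (hmemW hy).2) hR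
      _ ≤ R * θ y := by
          refine mul_le_mul_of_nonneg_left ?_ hR
          nlinarith [hθ0 y]
  have hinit : ∀ y, (if y ∈ Λ then R else 0) ≤ R * W.indicator 1 y + R * θ y := fun y => by
    by_cases hyW : y ∈ W
    · rw [Set.indicator_of_mem hyW, Pi.one_apply, mul_one]
      have : (if y ∈ Λ then R else 0) ≤ R := by split_ifs; exacts [le_rfl, hR]
      exact this.trans (le_add_of_nonneg_right (mul_nonneg hR (hθ0 y)))
    · rw [Set.indicator_of_notMem hyW, mul_zero, zero_add]
      by_cases hyΛ : y ∈ Λ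
      · have hyΔ : y ∈ Δg := by
          by_contra h'
          exact hyW ⟨Finset.mem_coe.2 hyΛ, fun h'' => h' (Finset.mem_coe.1 h'')⟩
        rw [if_pos hyΛ, hθg y hyΔ, mul_one]
      · rw [if_neg hyΛ]; exact mul_nonneg hR (hθ0 y)
  -- `f` is admissible with the global Lipschitz vector `δ_f 𝟙_{Δ_f}`
  have hF : Adm f := ⟨hfm, Mf, hMf⟩
  have hδ' : Lip f fun y => if y ∈ Δf then δf y else 0 := by
    refine ⟨fun y => ?_, summable_of_ne_finset_zero (s := Δf) fun y hy => if_neg hy,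
      fun σ τ => abs_sub_le_tsum_of_dependsOn hfdep hδf σ τ⟩
    dsimp only
    split_ifs
    · exact hδf.nonneg y
    · exact le_rfl
  have key := abs_sub_le_tsum_of_superSolution_of_estimate (W := W) (T := fun x F => siteAvg γ x F)
    (E₁ := fun F => ∫ σ, F σ ∂(γ Λ η)) (E₂ := fun F => (∫ σ, g σ * F σ ∂(γ Λ η)) / ∫ σ, g σ ∂(γ Λ η))
    hlip0 hlips hC0 hCs hT hdust h₁T h₂T hc0 hc1 hrowW ha
    (fun y => by split_ifs; exacts [hR, le_rfl]) (fun y => by split_ifs; exacts [le_rfl, hR])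
    (astar := fun y => R * θ y) (fun y => mul_nonneg hR (hθ0 y)) (Bs := R)
    (fun y => by simpa using mul_le_mul_of_nonneg_left (hθ1 y) hR) hsol hR hinit hF hδ'
  have hsum : (∑' y, R * θ y * (if y ∈ Δf then δf y else 0)) = R * ∑ y ∈ Δf, θ y * δf y := by
    rw [tsum_eq_sum (s := Δf) (fun y hy => by rw [if_neg hy, mul_zero]), Finset.mul_sum]
    exact Finset.sum_congr rfl fun y hy => by rw [if_pos hy]; ring
  rw [← hsum]
  exact key

/-- **Covariance estimate for the finite-volume kernels under the weighted Dobrushin condition, infinite range with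
summable rows, Vasserstein form — uniformly in the volume and the boundary condition** (Föllmer 1988, Ch. I,
Thm. (2.13) with Cor. (2.14) for the conditional specification (2.10); Georgii 2011, Remark 8.26 and §8.2; Künsch 1982;
the Lipschitz-observable form of Dobrushin–Shlosman's finite-volume mixing): under the global Kantorovich–Rubinstein
bound with summable rows, for EVERY finite `Λ`, EVERY boundary condition `η`, bounded measurable local `f, g` with
coordinatewise Lipschitz bounds `δ_f, δ_g` and dependence sets `Δ_f, Δ_g`, rows `≤ c < 1` off `Δ_g` and a weight
`0 ≤ θ ≤ 1`, `= 1` on `Δ_g`, with `∑' y, C x y θ y ≤ c θ x` off `Δ_g`: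
`|cov_{γ_Λ(·|η)}(f, g)| ≤ 2 R² (∑_{y ∈ Δ_g} δ_g y) ∑_{y ∈ Δ_f} θ y δ_f y` — the bound of
`abs_covariance_le_of_summable_weighted` for Gibbs measures (tilt trick: `γ_Λ(·|η)` versus `g̃ γ_Λ(·|η)/γ_Λ(g̃|η)`,
`g̃ = g − g(τ₀) + R ∑ δ_g ≥ 0`). [cite: Follmer1988, Ch. I Theorem (2.13)] -/
theorem abs_covariance_kernel_le_of_summable_weighted [DecidableEq V] (hγ : IsSpecification γ)
    {R : ℝ} (hr0 : ∀ a b, 0 ≤ r a b) (hrR : ∀ a b, r a b ≤ R) (hR : 0 ≤ R)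
    (hr00 : ∀ a, r a a = 0) (hC0 : ∀ x y, 0 ≤ C x y) (hCs : ∀ x, Summable (C x))
    (hcontr : ∀ (x : V) (ω η : V → S) (φ : S → ℝ) (L : ℝ), Measurable φ →
      (∃ M, ∀ s, |φ s| ≤ M) → 0 ≤ L → (∀ a b, |φ a - φ b| ≤ L * r a b) →
      |∫ s, φ s ∂(siteLaw γ x ω) - ∫ s, φ s ∂(siteLaw γ x η)| ≤
        L * ∑' y, C x y * r (ω y) (η y))
    (Λ : Finset V) (η : V → S) {f g : (V → S) → ℝ}
    (hfm : Measurable f) {Δf : Finset V} (hfdep : DependsOn f (↑Δf : Set V)) {Mf : ℝ}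
    (hMf : ∀ σ, |f σ| ≤ Mf) {δf : V → ℝ} (hδf : IsLipBound r f δf) (hgm : Measurable g)
    {Δg : Finset V} (hgdep : DependsOn g (↑Δg : Set V)) {Mg : ℝ} (hMg : ∀ σ, |g σ| ≤ Mg)
    {δg : V → ℝ} (hδg : IsLipBound r g δg) {c : ℝ} (hc0 : 0 ≤ c) (hc1 : c < 1)
    (hrow : ∀ x ∉ Δg, ∑' y, C x y ≤ c) {θ : V → ℝ} (hθ0 : ∀ y, 0 ≤ θ y) (hθ1 : ∀ y, θ y ≤ 1)
    (hθg : ∀ y ∈ Δg, θ y = 1) (hroww : ∀ x ∉ Δg, ∑' y, C x y * θ y ≤ c * θ x) :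
    |cov[f, g; γ Λ η]| ≤ 2 * R ^ 2 * (∑ y ∈ Δg, δg y) * ∑ y ∈ Δf, θ y * δf y := by
  classical
  haveI := hγ.isProbability Λ η
  obtain ⟨τ₀, -⟩ := nonempty_of_measure_ne_zero (μ := γ Λ η) (s := Set.univ) (by simp)
  -- the shifted density `g̃ ∈ [0, 2 S_g]`
  set Sg : ℝ := R * ∑ y ∈ Δg, δg y with hSg
  have hSg0 : 0 ≤ Sg := mul_nonneg hR (Finset.sum_nonneg fun y _ => hδg.nonneg y)
  set gt : (V → S) → ℝ := fun σ => g σ + (Sg - g τ₀) with hgt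
  have hosc' : ∀ σ, |g σ - g τ₀| ≤ Sg := fun σ =>
    abs_sub_le_mul_sum_of_dependsOn hrR hgdep hδg σ τ₀
  have hgt0 : ∀ σ, 0 ≤ gt σ := fun σ => by
    have := (abs_le.1 (hosc' σ)).1; simp only [hgt]; linarith
  have hgtB : ∀ σ, gt σ ≤ 2 * Sg := fun σ => by
    have := (abs_le.1 (hosc' σ)).2; simp only [hgt]; linarith
  have hgtm : Measurable gt := hgm.add_const _
  have hgtdep : DependsOn gt (↑Δg : Set V) := fun σ τ h => by
    simp only [hgt]; rw [hgdep h]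
  have hgi : Integrable g (γ Λ η) := integrable_of_abs_le' hgm hMg
  have hfi : Integrable f (γ Λ η) := integrable_of_abs_le' hfm hMf
  have hgtabs : ∀ σ, |gt σ| ≤ 2 * Sg := fun σ => by
    rw [abs_of_nonneg (hgt0 σ)]; exact hgtB σ
  have hgti : Integrable gt (γ Λ η) := integrable_of_abs_le' hgtm hgtabs
  -- the right-hand side is nonnegative
  have hRHS : 0 ≤ 2 * R ^ 2 * (∑ y ∈ Δg, δg y) * ∑ y ∈ Δf, θ y * δf y := by
    have h1 : 0 ≤ ∑ y ∈ Δg, δg y := Finset.sum_nonneg fun y _ => hδg.nonneg y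
    have h2 : 0 ≤ ∑ y ∈ Δf, θ y * δf y :=
      Finset.sum_nonneg fun y _ => mul_nonneg (hθ0 y) (hδf.nonneg y)
    positivity
  -- `cov(f, g) = cov(f, g̃) = γ(f g̃) - γ(f) γ(g̃)`
  have hcov : cov[f, g; γ Λ η] =
      ∫ σ, f σ * gt σ ∂(γ Λ η) - (∫ σ, f σ ∂(γ Λ η)) * ∫ σ, gt σ ∂(γ Λ η) := by
    have h1 : cov[f, g; γ Λ η] = cov[f, gt; γ Λ η] := by
      rw [hgt, covariance_add_const_right hgi]
    rw [h1, covariance_eq_sub]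
    · rfl
    · exact memLp_of_bounded (a := -Mf) (b := Mf)
        (ae_of_all _ fun σ => abs_le.1 (hMf σ)) hfm.aestronglyMeasurable 2
    · exact memLp_of_bounded (a := -(2 * Sg)) (b := 2 * Sg)
        (ae_of_all _ fun σ => abs_le.1 (hgtabs σ)) hgtm.aestronglyMeasurable 2
  by_cases hz : ∫ σ, gt σ ∂(γ Λ η) = 0
  · -- degenerate case: `g̃ = 0` a.e., so the covariance vanishes
    have hae : gt =ᵐ[γ Λ η] 0 := (integral_eq_zero_iff_of_nonneg (fun σ => hgt0 σ) hgti).1 hz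
    have hfg : ∫ σ, f σ * gt σ ∂(γ Λ η) = 0 := by
      rw [← integral_zero (α := V → S) (μ := γ Λ η) (G := ℝ)]
      refine integral_congr_ae ?_
      filter_upwards [hae] with σ hσ
      simp [hσ]
    rw [hcov, hfg, hz, mul_zero, sub_zero, abs_zero]
    exact hRHS
  have hpos : 0 < ∫ σ, gt σ ∂(γ Λ η) := lt_of_le_of_ne (integral_nonneg hgt0) (Ne.symm hz)
  -- the comparison estimate between the kernel and its tilt by `g̃`
  have key' := abs_tilt_sub_kernel_le_of_summable_weighted hγ hr0 hrR hR hr00 hC0 hCs hcontr Λ η hgtm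
    hgtdep hgt0 hgtB hpos hc0 hc1 hrow hθ0 hθ1 hθg hroww hfm hfdep hMf hδf
  -- `cov = γ(g̃) · (γ_{g̃}(f) - γ(f))`
  have hfgt : ∫ σ, f σ * gt σ ∂(γ Λ η) = ∫ σ, gt σ * f σ ∂(γ Λ η) :=
    integral_congr_ae (ae_of_all _ fun σ => mul_comm _ _)
  have hident : cov[f, g; γ Λ η] = (∫ σ, gt σ ∂(γ Λ η)) *
      ((∫ σ, gt σ * f σ ∂(γ Λ η)) / ∫ σ, gt σ ∂(γ Λ η) - ∫ σ, f σ ∂(γ Λ η)) := by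
    rw [hcov, hfgt, mul_sub, mul_div_cancel₀ _ hz]
    ring
  rw [hident, abs_mul, abs_of_pos hpos, abs_sub_comm]
  have hgtint : ∫ σ, gt σ ∂(γ Λ η) ≤ 2 * Sg := by
    calc ∫ σ, gt σ ∂(γ Λ η) ≤ ∫ _σ, 2 * Sg ∂(γ Λ η) := integral_mono hgti (integrable_const _) hgtB
      _ = 2 * Sg := by simp
  calc (∫ σ, gt σ ∂(γ Λ η)) *
        |(∫ σ, f σ ∂(γ Λ η)) - (∫ σ, gt σ * f σ ∂(γ Λ η)) / ∫ σ, gt σ ∂(γ Λ η)|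
      ≤ (2 * Sg) * (R * ∑ y ∈ Δf, θ y * δf y) :=
        mul_le_mul hgtint key' (abs_nonneg _) (by positivity)
    _ = 2 * R ^ 2 * (∑ y ∈ Δg, δg y) * ∑ y ∈ Δf, θ y * δf y := by
        rw [hSg]; ring

end Kernel

end DobrushinMetric

end Literature.Probability.LatticeModels

end
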